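import Summits.QuantumFields.BalabanUV.Beta.EriceRemainderEnclosureHistoryAutonomyComparisonAgeCompositionGeometricCoverFlow

/-!
# EriceRemainderEnclosureHistoryAutonomyComparisonAgeCompositionGeometricCoverFlowMass — (E114e) route (N), first order: THE GEOMETRIC COVER IN THE CENSUS
# LETTERS — MASS `1.18` BEYOND THE LIGHT LOAD.  (E114d)'s criterion `Σ_l r·KA 1 m l∕(1 − r·KA 1 m l) ≤ −log(1−r)` (`r = √2∕4`, undamped) in terms of the two
# displayed letters of the census, the total window load `T(m) = Σ_{k<K} k·L_kh(m+k)³∕2` and the top entry `F(m) = Σ_{k<K} L_kh(m+k)³∕2`: every entry of the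
# aggregate row is at most the top entry (**`aggregate_le_top_undamped`**, `top_le_top_entry_undamped`) and the row mass is at most `T(m)` ((E89b)
# `undamped_mass_le_window_loads`), so the criterion follows from `r·T(m)∕(1 − r·F(m)) ≤ −log(1 − r)`; with `−log(1 − √2∕4) ≥ 0.426` (**`neg_log_one_sub_r_ge`**:
# four Taylor terms, Mathlib's `Real.abs_log_sub_add_sum_range_le`) this is **`flow_nonneg_of_mass_le_undamped`**: along every box solution of an isotone memory with
# floor dominating `L ≥ 0`, ANY range, ANY horizon, `g ≡ 1`:
#     `T(m) ≤ 1.18` and `F(m) ≤ 0.03` at every pin ⟹ `0 ≤ ε ≤ e`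
# — against `T(m) ≤ 1` for the light load ((E86i)∕(E89b)) and `≈ 1 + F` for the next-row certificate: the old-dominated frontier (old-only windows `[16,16R]`:
# `F ≈ 0.02`, `T = 1.03` at R = 2^18, K ≈ 2^22, where (YO) dies; +0.029∕octave, exact multi-slope LPs) moves to R = 2^23, K ≈ 2^27 (README
# `HOME/b2b-balaban-beta-d4-p2/g95/README.md` §2, §4, §5; the LP-optimal cover there has mass 0.68–0.75, so the constant `r` is far from sharp — (E114f∕g) and successor item (2)).

Cell `pub-balaban`, β-function sub-cell, BINDER row D4 «RemainderConst leaves for Bałaban's split» (`HOME/BINDER-OWNERS.md`; owner lineage `b2b-balaban-beta-an4`;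
this file by co-owner #2 lineage `b2b-balaban-beta-d4-p2`, generation 95), β-FLOW TEAM duty (1), FREEZE (0) honoured (def-free; imports (E114d); uses (E114d)
`flow_nonneg_of_geometric_cover_undamped`, (E113d) `aggregate_one_eq`, (E80a) `weight_nonneg`, (E89b) `undamped_mass_le_window_loads`, Mathlib's
`Real.abs_log_sub_add_sum_range_le` BY NAME; the display of `KL`, `KA`, `RA` is (E86i)'s VERBATIM; nothing restated).

HONEST FRAMING (page 1, verbatim and binding).  *"Discharging BetaPertH makes Bałaban's UV stability UNCONDITIONAL — a real constructive-QFT result; it is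
NOT the continuum limit and NOT the Clay problem."*  THIS FILE DISCHARGES NOTHING OF THE KIND.  Elementary real analysis about ABSTRACT functionals on a box
]0,γ]^ℕ with displayed floors, profiles and signs, and the FIRST-ORDER renewal objects of route (N) built from them — hypotheses of a census, not facts; the
form, signs, ages and moments of Bałaban's (1.22) limit functional are NOT PRINTED ([I] p. 298; GAPS G-t4-U2-1∕-2) and NOT asserted.  Row D4 class
UNCHANGED (critical-path width 0; instance 0∕1; D4 DISCHARGE NO DATE).  HONEST DEPENDENCY: continuum YM on T⁴ ⇐ BetaPertH ∧ nine spine estimates (0/9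
proved); BetaPertH ⇐ (D1) ∧ (D4) ∧ CAP+tail; G-an2-4 gates asym, D1 and NE2/3/4.

NOT CLAIMED: `T ≤ 1.18 ∧ F ≤ 0.03` along every flow (false beyond K ≈ 2^26 on the old-only frontier; and young-heavy profiles have `F ≈ 0.5` — for them (YO) is the
tool); the damped system; anything printed — NOT B12 Thm 2, NOT BetaPertH.

WHAT IS PROVED ([folklore]; 0 `def`, 0 sorry).  §1 **`aggregate_le_top_undamped`**, `top_le_top_entry_undamped`.  §2 `sqrt_two_div_four_bounds`, **`neg_log_one_sub_r_ge`**.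
§3 **`flow_nonneg_of_mass_le_undamped`**.
-/
noncomputable section
open Finset

namespace Summit.QuantumFields.BalabanUV.Beta.EriceRemainderEnclosureHistoryAutonomyComparisonAgeCompositionGeometricCoverFlowMass

open Literature.MathematicalPhysics.QuantumFieldTheory.Balaban1983to89
open Literature.MathematicalPhysics.QuantumFieldTheory.Balaban1983to89.T4BetaStationary
open Literature.MathematicalPhysics.QuantumFieldTheory.Balaban1983to89.T4BetaFlowWellPosed
open Summit.QuantumFields.BalabanUV.Beta.EriceRemainderEnclosureHistoryAutonomyComparisonAgeCompositionIdentification (weight_nonneg)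
open Summit.QuantumFields.BalabanUV.Beta.EriceRemainderEnclosureHistoryAutonomyComparisonAgeCompositionNextRowAges (aggregate_one_eq)
open Summit.QuantumFields.BalabanUV.Beta.EriceRemainderEnclosureHistoryAutonomyComparisonAgeCompositionThreeAgesMassCap (undamped_mass_le_window_loads)
open Summit.QuantumFields.BalabanUV.Beta.EriceRemainderEnclosureHistoryAutonomyComparisonAgeCompositionGeometricCoverFlow (flow_nonneg_of_geometric_cover_undamped)

variable {B : (ℕ → ℝ) → ℝ} {γ b gIR : ℝ} {L : ℕ → ℝ} {K : ℕ} {h g : ℕ → ℝ} {KL : ℕ → ℕ → ℕ → ℝ}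

/-! ## §1 Every entry of the undamped aggregate row is at most the top entry -/

/-- **THE UNDAMPED AGGREGATE ROW IS NON-INCREASING FROM ITS TOP ENTRY**: `g ≡ 1` ⟹ `KA 1 m l ≤ KA 1 m 0` (tail sums of the same non-negative terms). [folklore] -/
theorem aggregate_le_top_undamped (hL : ∀ k, 0 ≤ L k) (hh : SeqBox γ h) (hg1 : ∀ t, g t = 1) (hK : 1 ≤ K)
    (hKL : ∀ k n l, KL k n l = if 0 < k ∧ k < K ∧ l < k then L k * h (n + k) ^ 3 / 2 * ∏ t ∈ Ico (n + 1 + l) (n + k + 1), g t else 0)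
    {KA : ℕ → ℕ → ℕ → ℝ} (hKA : ∀ i m l, KA i m l = KL i m l + KA (i + 1) m l) (hKAtop : ∀ m l, KA K m l = 0) (m l : ℕ) :
    KA 1 m l ≤ KA 1 m 0 := by
  have hg : ∀ t, 0 < g t ∧ g t ≤ 1 := fun t => by rw [hg1 t]; norm_num
  have hh0 : ∀ n, 0 < h n := fun n => (hh n).1
  have hKL0 := weight_nonneg hL hh0 hg hKL
  have hprod : ∀ a c : ℕ, ∏ t ∈ Ico a c, g t = 1 := fun a c => prod_eq_one fun t _ => hg1 t
  rw [aggregate_one_eq hK hKA hKAtop m l, aggregate_one_eq hK hKA hKAtop m 0]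
  refine sum_le_sum fun k hk => ?_
  have hk := mem_Ico.mp hk
  by_cases hlk : l < k
  · rw [hKL k m l, if_pos ⟨hk.1, hk.2, hlk⟩, hKL k m 0, if_pos ⟨hk.1, hk.2, hk.1⟩, hprod, hprod]
  · rw [hKL k m l, if_neg (by omega)]; exact hKL0 k m 0

/-- The top entry is at most the displayed letter `F(m) = Σ_{k<K} L_kh(m+k)³∕2` (undamped: equal up to the empty age `0`). [folklore] -/
theorem top_le_top_entry_undamped (hL : ∀ k, 0 ≤ L k) (hh : SeqBox γ h) (hg1 : ∀ t, g t = 1) (hK : 1 ≤ K)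
    (hKL : ∀ k n l, KL k n l = if 0 < k ∧ k < K ∧ l < k then L k * h (n + k) ^ 3 / 2 * ∏ t ∈ Ico (n + 1 + l) (n + k + 1), g t else 0)
    {KA : ℕ → ℕ → ℕ → ℝ} (hKA : ∀ i m l, KA i m l = KL i m l + KA (i + 1) m l) (hKAtop : ∀ m l, KA K m l = 0) (m : ℕ) :
    KA 1 m 0 ≤ ∑ k ∈ range K, L k * h (m + k) ^ 3 / 2 := by
  have hh0 : ∀ n, 0 < h n := fun n => (hh n).1
  have hprod : ∀ a c : ℕ, ∏ t ∈ Ico a c, g t = 1 := fun a c => prod_eq_one fun t _ => hg1 t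
  rw [aggregate_one_eq hK hKA hKAtop m 0]
  calc ∑ k ∈ Ico 1 K, KL k m 0 = ∑ k ∈ Ico 1 K, L k * h (m + k) ^ 3 / 2 := sum_congr rfl fun k hk => by
          have hk := mem_Ico.mp hk
          rw [hKL k m 0, if_pos ⟨hk.1, hk.2, hk.1⟩, hprod, mul_one]
    _ ≤ ∑ k ∈ range K, L k * h (m + k) ^ 3 / 2 :=
        sum_le_sum_of_subset_of_nonneg (fun k hk => mem_range.mpr (mem_Ico.mp hk).2) fun k _ _ => by
          have := hL k; have := hh0 (m + k); positivity

/-! ## §2 The constant: `−log(1 − √2∕4) ≥ 0.426` -/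

/-- `0.35355 ≤ √2∕4 ≤ 0.353554`. [folklore] -/
theorem sqrt_two_div_four_bounds : (0.35355 : ℝ) ≤ Real.sqrt 2 / 4 ∧ Real.sqrt 2 / 4 ≤ 0.353554 := by
  have hlo : (1.4142 : ℝ) ≤ Real.sqrt 2 := by
    rw [show (1.4142 : ℝ) = Real.sqrt (1.4142 ^ 2) by rw [Real.sqrt_sq (by norm_num)]]
    exact Real.sqrt_le_sqrt (by norm_num)
  have hhi : Real.sqrt 2 ≤ 1.414216 := by
    rw [show (1.414216 : ℝ) = Real.sqrt (1.414216 ^ 2) by rw [Real.sqrt_sq (by norm_num)]]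
    exact Real.sqrt_le_sqrt (by norm_num)
  constructor <;> linarith

/-- **`−log(1 − √2∕4) ≥ 0.426`** (`x + x²∕2 + x³∕3 + x⁴∕4 − x⁵∕(1−x)` at `x = √2∕4`, Mathlib's `Real.abs_log_sub_add_sum_range_le`). [folklore] -/
theorem neg_log_one_sub_r_ge : (0.426 : ℝ) ≤ -Real.log (1 - Real.sqrt 2 / 4) := by
  obtain ⟨hlo, hhi⟩ := sqrt_two_div_four_bounds
  set x : ℝ := Real.sqrt 2 / 4 with hx
  have hx0 : 0 ≤ x := by linarith
  have habs : |x| = x := abs_of_nonneg hx0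
  have h1 : |x| < 1 := by rw [habs]; linarith
  have ht := Real.abs_log_sub_add_sum_range_le h1 4
  rw [habs] at ht
  have hup := (abs_le.mp ht).2
  -- the Taylor sum, written out
  have hS : ∑ i ∈ range 4, x ^ (i + 1) / (i + 1) = x + x ^ 2 / 2 + x ^ 3 / 3 + x ^ 4 / 4 := by
    simp only [sum_range_succ, sum_range_zero]
    norm_num
  rw [hS] at hup
  -- numeric bounds on the powers and the remainder
  have h2 : (0.35355 : ℝ) ^ 2 ≤ x ^ 2 := pow_le_pow_left₀ (by norm_num) hlo 2
  have h3 : (0.35355 : ℝ) ^ 3 ≤ x ^ 3 := pow_le_pow_left₀ (by norm_num) hlo 3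
  have h4 : (0.35355 : ℝ) ^ 4 ≤ x ^ 4 := pow_le_pow_left₀ (by norm_num) hlo 4
  have h5 : x ^ 5 ≤ (0.353554 : ℝ) ^ 5 := pow_le_pow_left₀ hx0 hhi 5
  have hrem : x ^ (4 + 1) / (1 - x) ≤ (0.353554 : ℝ) ^ 5 / (1 - 0.353554) := by
    rw [show (4 + 1 : ℕ) = 5 by norm_num]
    exact div_le_div₀ (by norm_num) h5 (by norm_num) (by linarith)
  have hnum : (0.426 : ℝ) ≤ 0.35355 + 0.35355 ^ 2 / 2 + 0.35355 ^ 3 / 3 + 0.35355 ^ 4 / 4 - (0.353554 : ℝ) ^ 5 / (1 - 0.353554) := by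
    norm_num
  linarith

/-! ## §3 The END from `T ≤ 1.18`, `F ≤ 0.03` (undamped) -/

/-- **ROUTE (N), FIRST ORDER — MASS `1.18` BEYOND THE LIGHT LOAD (UNDAMPED; ANY PROFILE, ANY RANGE, ANY HORIZON).**  `B` an isotone memory on the box with floor
`b > 0` dominating the profile `L ≥ 0` on the ages `< K` (`K ≥ 1`); `h` a box solution from any pin; `g ≡ 1`; `KL`, `KA`, `RA` as displayed; horizon `N ≥ K`.  IF at
every pin the total window load and the top entry satisfy `Σ_{k<K} k·L_kh(m+k)³∕2 ≤ 1.18` and `Σ_{k<K} L_kh(m+k)³∕2 ≤ 0.03`, THEN `0 ≤ ε m ≤ e m` at every pin for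
every admissible excess ((E114d) `flow_nonneg_of_geometric_cover_undamped`: `r·T∕(1 − r·F) ≤ 0.4217 ≤ 0.426 ≤ −log(1−r)`, `r = √2∕4`). [folklore] -/
theorem flow_nonneg_of_mass_le_undamped (hmono : ∀ u v : ℕ → ℝ, SeqBox γ u → SeqBox γ v → (∀ j, u j ≤ v j) → B u ≤ B v)
    (hL : ∀ k, 0 ≤ L k) (hb : 0 < b) (hlo : ∀ u, SeqBox γ u → b ≤ B u) (hh : SeqBox γ h) (hf : MemFlow B gIR h) (hg1 : ∀ t, g t = 1)
    (hK : 1 ≤ K) {N : ℕ} (hKN : K ≤ N)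
    (hKL : ∀ k n l, KL k n l = if 0 < k ∧ k < K ∧ l < k then L k * h (n + k) ^ 3 / 2 * ∏ t ∈ Ico (n + 1 + l) (n + k + 1), g t else 0)
    {KA : ℕ → ℕ → ℕ → ℝ} {RA : ℕ → (ℕ → ℝ) → ℕ → ℝ}
    (hRA : ∀ i v m, RA i v m = ∑ l ∈ range K, KA i m l * v (m + 1 + l))
    (hKA : ∀ i m l, KA i m l = KL i m l + KA (i + 1) m l) (hKAtop : ∀ m l, KA K m l = 0)
    (hT : ∀ m, ∑ k ∈ range K, (k : ℝ) * (L k * h (m + k) ^ 3 / 2) ≤ 1.18)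
    (hF : ∀ m, ∑ k ∈ range K, L k * h (m + k) ^ 3 / 2 ≤ 0.03)
    {e ε : ℕ → ℝ} (he0 : ∀ m, 0 ≤ e m) (hea : ∀ m, e (m + 1) ≤ e m)
    (hεt : ∀ m, N < m → ε m = 0) (hεrec : ∀ m, ε m = e m - RA 1 ε m) : ∀ m, 0 ≤ ε m ∧ ε m ≤ e m := by
  have hg : ∀ t, 0 < g t ∧ g t ≤ 1 := fun t => by rw [hg1 t]; norm_num
  have hh0 : ∀ n, 0 < h n := fun n => (hh n).1
  have hKL0 := weight_nonneg hL hh0 hg hKL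
  have hKA10 : ∀ m l, 0 ≤ KA 1 m l := fun m l => by
    rw [aggregate_one_eq hK hKA hKAtop]; exact sum_nonneg fun k _ => hKL0 k m l
  obtain ⟨hrlo, hrhi⟩ := sqrt_two_div_four_bounds
  set r : ℝ := Real.sqrt 2 / 4 with hr
  have hlog := neg_log_one_sub_r_ge
  -- every entry ≤ F(m) ≤ 0.03
  have hent : ∀ m l, KA 1 m l ≤ 0.03 := fun m l =>
    ((aggregate_le_top_undamped hL hh hg1 hK hKL hKA hKAtop m l).trans (top_le_top_entry_undamped hL hh hg1 hK hKL hKA hKAtop m)).trans (hF m)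
  have hrt : ∀ m l, r * KA 1 m l < 1 := fun m l => by
    have := mul_le_mul hrhi (hent m l) (hKA10 m l) (by norm_num); linarith
  refine flow_nonneg_of_geometric_cover_undamped hmono hL hb hlo hh hf hg1 hK hKN hKL hRA hKA hKAtop hrt (fun m => ?_) he0 hea hεt hεrec
  -- `Σ_l rK_l/(1 − rK_l) ≤ (r/(1 − 0.03 r)) Σ_l K_l ≤ (r/(1 − 0.03 r))·1.18 ≤ 0.4217`
  have hden : ∀ l, 1 - r * 0.03 ≤ 1 - r * KA 1 m l := fun l => by
    have := mul_le_mul_of_nonneg_left (hent m l) (show 0 ≤ r by linarith); linarith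
  have hden0 : 0 < 1 - r * 0.03 := by nlinarith
  have hterm : ∀ l ∈ range K, r * KA 1 m l / (1 - r * KA 1 m l) ≤ r * KA 1 m l / (1 - r * 0.03) := fun l _ =>
    div_le_div_of_nonneg_left (mul_nonneg (by linarith) (hKA10 m l)) hden0 (hden l)
  have hmass := (undamped_mass_le_window_loads hL hh hg hK hKL hKA hKAtop m).trans (hT m)
  calc ∑ l ∈ range K, r * KA 1 m l / (1 - r * KA 1 m l) ≤ ∑ l ∈ range K, r * KA 1 m l / (1 - r * 0.03) := sum_le_sum hterm
    _ = r / (1 - r * 0.03) * ∑ l ∈ range K, KA 1 m l := by rw [mul_sum]; exact sum_congr rfl fun l _ => by ring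
    _ ≤ r / (1 - r * 0.03) * 1.18 := mul_le_mul_of_nonneg_left hmass (div_nonneg (by linarith) hden0.le)
    _ ≤ 0.426 := by
        rw [div_mul_eq_mul_div, div_le_iff₀ hden0]
        nlinarith
    _ ≤ -Real.log (1 - r) := hlog

end Summit.QuantumFields.BalabanUV.Beta.EriceRemainderEnclosureHistoryAutonomyComparisonAgeCompositionGeometricCoverFlowMass

end
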